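import Mathlib
import Literature.NumberTheory.Sieve.Maynard2016GPYWeights
import Literature.NumberTheory.Sieve.Maynard2016Lemma6Split
import Literature.NumberTheory.Sieve.Maynard2016JointCount
import Literature.NumberTheory.Sieve.Maynard2016Growth
import Literature.NumberTheory.Sieve.Maynard2016TupleArith
import Literature.NumberTheory.Sieve.Maynard2016BaseSetCoprime
import Literature.NumberTheory.Sieve.Maynard2016PwClasses
import Literature.NumberTheory.Sieve.Maynard2016LamSupport
import Literature.NumberTheory.Sieve.Maynard2016LamModulus
import Literature.NumberTheory.Sieve.Maynard2016LamBound
import HarnessLib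

/-!
# Maynard 2016, Lemma 6 — the counting half (6.1)–(6.7), PROVED

J. Maynard, *Large gaps between primes*, Ann. of Math. 183 (2016) 915–933 (arXiv:1408.5110), §6,
proof of Lemma 6, displays (6.1)–(6.7). [cite: Maynard2016LargeGaps, §6]

We prove the named fact `Maynard2016.Lemma6Counting` of `Maynard2016Lemma6Split`:
for `C_U > 0`, all small `ε > 0`, `k ≥ 1` and smooth sieve data, for all large `x`, every `m ≥ 1`
and every prime `q ∈ [x/2, x]`,

`|α_{m,q}⁻¹ − (U/m) (φ_ω(P_w)/P_w) Σ'_{d,d',e,e'} λ_{d,e} λ_{d',e'}/[d,d',e,e']| ≤ x^{3/4}`.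

Steps, following the source:
* (6.1)–(6.2) `normInv_eq_sum_box`: expand the square and swap the order of summation; the inner
  object is the number of `n ≤ U/m`, `(n(mn−1), P_w) = 1` with `[d_j,d'_j] ∣ n + h_j q` and
  `[e_j,e'_j] ∣ m(n + h_j q) − 1` for all `j`;
* (6.3)–(6.6) `abs_quadTerm_sub_le`: on the support of `λλ'` the moduli are `< q`, so the system is
  soluble only under the conditions `Adm` (primes dividing two moduli are `> x/2 > z`, display (6.3)),
  and then the count is `⌊U/m⌋ φ_ω(P_w)/(P_w [d,d',e,e']) + O(φ_ω(P_w))` by the Chinese remainder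
  theorem (`Maynard2016JointCount`);
* (6.7) `sum_abs_lam_le`, `eventually_sizes`: `λ ≪ 1` supported on `∏ d_i ≤ x^{1/10}`, `e_i ≤ y`,
  so the error is `≪ P_w (x^{1/10} (1 + log x)^k y^k)² ≤ x^{3/4}`.
-/

open Filter Finset
open scoped BigOperators Topology

namespace Literature.NumberTheory.Sieve

namespace Maynard2016

/-! ### Support facts for `λ` -/

/-- `lcm` of squarefree naturals is squarefree. [folklore] -/
private theorem squarefree_lcm_of_squarefree {a b : ℕ} (ha : Squarefree a) (hb : Squarefree b) :
    Squarefree (Nat.lcm a b) := by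
  have ha0 : a ≠ 0 := ha.ne_zero
  have hb0 : b ≠ 0 := hb.ne_zero
  rw [Nat.squarefree_iff_factorization_le_one (Nat.lcm_ne_zero ha0 hb0)]
  intro p
  rw [Nat.factorization_lcm ha0 hb0]
  have h1 := (Nat.squarefree_iff_factorization_le_one ha0).1 ha p
  have h2 := (Nat.squarefree_iff_factorization_le_one hb0).1 hb p
  simp only [Finsupp.sup_apply]
  exact sup_le h1 h2

/-- `λ_{d,e} ≠ 0` forces every `d_i` and `e_i` to be squarefree (the Möbius factor).
[cite: Maynard2016LargeGaps, §5 display (5.3)] -/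
theorem squarefree_of_lam_ne_zero {k J : ℕ} {c : Fin J → ℝ} {Fd : Fin k → Fin J → ℝ → ℝ}
    {G : ℝ → ℝ} {ε : ℝ} {x : ℕ} {d e : Fin k → ℕ} (h : lam c Fd G ε x d e ≠ 0) (i : Fin k) :
    Squarefree (d i) ∧ Squarefree (e i) := by
  unfold lam at h
  have hprod := left_ne_zero_of_mul h
  have hi := (Finset.prod_ne_zero_iff.1 hprod) i (Finset.mem_univ i)
  constructor
  · apply ArithmeticFunction.moebius_ne_zero_iff_squarefree.1
    intro h0
    apply hi
    simp [h0]
  · apply ArithmeticFunction.moebius_ne_zero_iff_squarefree.1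
    intro h0
    apply hi
    simp [h0]

/-- `Σ_{1 ≤ t ≤ x} 1/t ≤ 1 + log x`. [folklore] -/
private theorem sum_Icc_inv_le (x : ℕ) :
    ∑ t ∈ Finset.Icc 1 x, (1 : ℝ) / t ≤ 1 + Real.log x := by
  have h : ∑ t ∈ Finset.Icc 1 x, (1 : ℝ) / t = (harmonic x : ℝ) := by
    rw [harmonic_eq_sum_Icc]
    push_cast
    refine Finset.sum_congr rfl fun t _ => by simp
  rw [h]
  exact harmonic_le_one_add_log x

/-! ### (6.1)–(6.2): expanding the square over the box `[1, x]^k` -/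

/-- A sum over `S` of a function vanishing off `B` is the sum over `B` of its restriction to `S`. [folklore] -/
private theorem sum_eq_sum_ite_mem {α M : Type*} [DecidableEq α] [AddCommMonoid M] (S B : Finset α)
    (g : α → M) (h : ∀ a ∈ S, a ∉ B → g a = 0) :
    ∑ a ∈ S, g a = ∑ a ∈ B, if a ∈ S then g a else 0 := by
  rw [← Finset.sum_filter, Finset.filter_mem_eq_inter, Finset.inter_comm, ← Finset.filter_mem_eq_inter]
  exact (Finset.sum_subset (Finset.filter_subset _ _) fun a ha hna => h a ha
    (fun hb => hna (Finset.mem_filter.2 ⟨ha, hb⟩))).symm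

/-- **The inner divisor sum over the box.** For `n ≥ 1`, `m, q ≥ 1`, `log x, log y > 0` and `y ≤ x`:
`Σ_{d_i ∣ n+h_iq, e_i ∣ m(n+h_iq)−1 ∀i} λ_{d,e} = Σ_{d, e ∈ [1,x]^k} [d_i ∣ n+h_iq, e_i ∣ m(n+h_iq)−1 ∀ i] λ_{d,e}`
(the weights vanish unless `d_i ≤ x^{1/10}` and `e_i ≤ y`). [cite: Maynard2016LargeGaps, §6 displays (6.1)–(6.2)] -/
theorem divSum_eq_sum_box {k J : ℕ} {c : Fin J → ℝ} {Fd : Fin k → Fin J → ℝ → ℝ} {G : ℝ → ℝ}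
    (hD : IsSieveData k J c Fd G) {ε : ℝ} {x : ℕ} (hx1 : 1 ≤ x) (hlogx : 0 < Real.log x)
    (hlogy : 0 < Real.log (y ε x)) (hyx : y ε x ≤ x) {m q n : ℕ} (hm : 1 ≤ m) (hq : 0 < q)
    (hn : 1 ≤ n) :
    divSum c Fd G ε x m q n = ∑ d ∈ box k x, ∑ e ∈ box k x,
      if (∀ i, d i ∣ n + hTuple k x i * q) ∧ (∀ i, e i ∣ m * (n + hTuple k x i * q) - 1)
      then lam c Fd G ε x d e else 0 := by
  classical
  have hN : ∀ i, 0 < n + hTuple k x i * q := fun i => by positivity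
  have hM : ∀ i, 0 < m * (n + hTuple k x i * q) - 1 := fun i => by
    have h1 : 1 ≤ hTuple k x i * q := Nat.mul_pos (hTuple_pos k x i) hq
    have h2 : 2 ≤ m * (n + hTuple k x i * q) :=
      le_trans (by omega) (Nat.mul_le_mul hm (le_refl _))
    omega
  have hx10 : (x : ℝ) ^ (1 / 10 : ℝ) ≤ x := by
    have h1 : (1 : ℝ) ≤ x := by exact_mod_cast hx1
    calc (x : ℝ) ^ (1 / 10 : ℝ) ≤ (x : ℝ) ^ (1 : ℝ) :=
          Real.rpow_le_rpow_of_exponent_le h1 (by norm_num)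
      _ = x := Real.rpow_one _
  -- membership in the divisor boxes
  have hmemD : ∀ d : Fin k → ℕ, d ∈ Fintype.piFinset (fun i => (n + hTuple k x i * q).divisors) ↔
      ∀ i, d i ∣ n + hTuple k x i * q := fun d => by
    simp only [Fintype.mem_piFinset, Nat.mem_divisors]
    exact forall_congr' fun i => ⟨fun h => h.1, fun h => ⟨h, (hN i).ne'⟩⟩
  have hmemE : ∀ e : Fin k → ℕ,
      e ∈ Fintype.piFinset (fun i => (m * (n + hTuple k x i * q) - 1).divisors) ↔
        ∀ i, e i ∣ m * (n + hTuple k x i * q) - 1 := fun e => by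
    simp only [Fintype.mem_piFinset, Nat.mem_divisors]
    exact forall_congr' fun i => ⟨fun h => h.1, fun h => ⟨h, (hM i).ne'⟩⟩
  -- off the box `[1,x]^k` the weights vanish
  have hnotbox : ∀ d : Fin k → ℕ, (∀ i, 1 ≤ d i) → d ∉ box k x → ∃ i, (x : ℝ) < d i := by
    intro d hd hnd
    simp only [box, Fintype.mem_piFinset, Finset.mem_Icc, not_forall, not_and, not_le] at hnd
    obtain ⟨i, hi⟩ := hnd
    exact ⟨i, by exact_mod_cast hi (hd i)⟩
  unfold divSum
  -- the `e`-sum, for any fixed `d`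
  have hinner : ∀ d : Fin k → ℕ,
      ∑ e ∈ Fintype.piFinset (fun i => (m * (n + hTuple k x i * q) - 1).divisors), lam c Fd G ε x d e =
        ∑ e ∈ box k x, if (∀ i, e i ∣ m * (n + hTuple k x i * q) - 1)
          then lam c Fd G ε x d e else 0 := by
    intro d
    rw [sum_eq_sum_ite_mem _ (box k x)]
    · exact Finset.sum_congr rfl fun e _ => if_congr (hmemE e) rfl rfl
    · intro e he hnb
      have he1 : ∀ i, 1 ≤ e i := fun i =>
        Nat.pos_of_dvd_of_pos (((hmemE e).1 he) i) (hM i)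
      obtain ⟨i, hi⟩ := hnotbox e he1 hnb
      exact lam_eq_zero_of_y_lt hD hlogy (lt_of_le_of_lt hyx hi)
  rw [sum_eq_sum_ite_mem _ (box k x)]
  · refine Finset.sum_congr rfl fun d _ => ?_
    rw [hinner]
    by_cases hdiv : ∀ i, d i ∣ n + hTuple k x i * q
    · rw [if_pos ((hmemD d).2 hdiv)]
      exact Finset.sum_congr rfl fun e _ => by rw [if_congr (and_iff_right hdiv) rfl rfl]
    · rw [if_neg (mt (hmemD d).1 hdiv)]
      symm
      exact Finset.sum_eq_zero fun e _ => by simp only [hdiv, false_and, if_false]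
  · intro d hd hnb
    have hd1 : ∀ i, 1 ≤ d i := fun i => Nat.pos_of_dvd_of_pos (((hmemD d).1 hd) i) (hN i)
    obtain ⟨i, hi⟩ := hnotbox d hd1 hnb
    refine Finset.sum_eq_zero fun e _ => ?_
    exact lam_eq_zero_of_rpow_lt hD hlogx hd1 (lt_of_le_of_lt hx10 hi)

/-- **(6.2): `α_{m,q}⁻¹` as a sum over quadruples.** Under the hypotheses of `divSum_eq_sum_box`:
`Σ_n (Σ λ)² = Σ_{d,d',e,e' ∈ [1,x]^k} λ_{d,e} λ_{d',e'} · #{n ≤ U/m, (n(mn−1),P_w)=1 : [d_j,d'_j] ∣ n+h_jq,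
[e_j,e'_j] ∣ m(n+h_jq)−1 ∀ j}`. [cite: Maynard2016LargeGaps, §6 display (6.2)] -/
theorem normInv_eq_sum_box {k J : ℕ} {c : Fin J → ℝ} {Fd : Fin k → Fin J → ℝ → ℝ} {G : ℝ → ℝ}
    (hD : IsSieveData k J c Fd G) {C_U ε : ℝ} {x : ℕ} (hx1 : 1 ≤ x) (hlogx : 0 < Real.log x)
    (hlogy : 0 < Real.log (y ε x)) (hyx : y ε x ≤ x) {m q : ℕ} (hm : 1 ≤ m) (hq : 0 < q) :
    normInv c Fd G C_U ε x m q = ∑ d ∈ box k x, ∑ d' ∈ box k x, ∑ e ∈ box k x, ∑ e' ∈ box k x,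
      lam c Fd G ε x d e * lam c Fd G ε x d' e' *
        ((((baseSet C_U ε x m).filter (fun n => ∀ j ∈ (Finset.univ : Finset (Fin k)),
            Nat.lcm (d j) (d' j) ∣ n + hTuple k x j * q ∧
              Nat.lcm (e j) (e' j) ∣ m * (n + hTuple k x j * q) - 1)).card : ℕ) : ℝ) := by
  classical
  unfold normInv
  have hstep : ∀ n ∈ baseSet C_U ε x m, divSum c Fd G ε x m q n ^ 2 =
      ∑ d ∈ box k x, ∑ d' ∈ box k x, ∑ e ∈ box k x, ∑ e' ∈ box k x,
        (if (∀ i, d i ∣ n + hTuple k x i * q) ∧ (∀ i, e i ∣ m * (n + hTuple k x i * q) - 1)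
          then lam c Fd G ε x d e else 0) *
        (if (∀ i, d' i ∣ n + hTuple k x i * q) ∧ (∀ i, e' i ∣ m * (n + hTuple k x i * q) - 1)
          then lam c Fd G ε x d' e' else 0) := by
    intro n hn
    have hn1 : 1 ≤ n := (mem_baseSet.1 hn).1.1
    rw [divSum_eq_sum_box hD hx1 hlogx hlogy hyx hm hq hn1, sq, Finset.sum_mul_sum]
    refine Finset.sum_congr rfl fun d _ => Finset.sum_congr rfl fun d' _ => ?_
    rw [Finset.sum_mul_sum]
  rw [Finset.sum_congr rfl hstep, Finset.sum_comm]
  refine Finset.sum_congr rfl fun d _ => ?_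
  rw [Finset.sum_comm]
  refine Finset.sum_congr rfl fun d' _ => ?_
  rw [Finset.sum_comm]
  refine Finset.sum_congr rfl fun e _ => ?_
  rw [Finset.sum_comm]
  refine Finset.sum_congr rfl fun e' _ => ?_
  -- the `n`-sum of the product of the two indicators
  have hterm : ∀ n ∈ baseSet C_U ε x m,
      (if (∀ i, d i ∣ n + hTuple k x i * q) ∧ (∀ i, e i ∣ m * (n + hTuple k x i * q) - 1)
          then lam c Fd G ε x d e else 0) *
        (if (∀ i, d' i ∣ n + hTuple k x i * q) ∧ (∀ i, e' i ∣ m * (n + hTuple k x i * q) - 1)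
          then lam c Fd G ε x d' e' else 0) =
      if (∀ j ∈ (Finset.univ : Finset (Fin k)), Nat.lcm (d j) (d' j) ∣ n + hTuple k x j * q ∧
          Nat.lcm (e j) (e' j) ∣ m * (n + hTuple k x j * q) - 1)
        then lam c Fd G ε x d e * lam c Fd G ε x d' e' else 0 := by
    intro n _
    have hiff : ((∀ i, d i ∣ n + hTuple k x i * q) ∧ (∀ i, e i ∣ m * (n + hTuple k x i * q) - 1)) ∧
        ((∀ i, d' i ∣ n + hTuple k x i * q) ∧ (∀ i, e' i ∣ m * (n + hTuple k x i * q) - 1)) ↔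
        (∀ j ∈ (Finset.univ : Finset (Fin k)), Nat.lcm (d j) (d' j) ∣ n + hTuple k x j * q ∧
          Nat.lcm (e j) (e' j) ∣ m * (n + hTuple k x j * q) - 1) := by
      simp only [Finset.mem_univ, true_implies, Nat.lcm_dvd_iff]
      exact ⟨fun h j => ⟨⟨h.1.1 j, h.2.1 j⟩, ⟨h.1.2 j, h.2.2 j⟩⟩,
        fun h => ⟨⟨fun j => (h j).1.1, fun j => (h j).2.1⟩, ⟨fun j => (h j).1.2, fun j => (h j).2.2⟩⟩⟩
    by_cases h1 : (∀ i, d i ∣ n + hTuple k x i * q) ∧ (∀ i, e i ∣ m * (n + hTuple k x i * q) - 1)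
    · by_cases h2 : (∀ i, d' i ∣ n + hTuple k x i * q) ∧
        (∀ i, e' i ∣ m * (n + hTuple k x i * q) - 1)
      · rw [if_pos h1, if_pos h2, if_pos (hiff.1 ⟨h1, h2⟩)]
      · rw [if_pos h1, if_neg h2, if_neg (fun h => h2 (hiff.2 h).2), mul_zero]
    · rw [if_neg h1, zero_mul, if_neg (fun h => h1 (hiff.2 h).1)]
  rw [Finset.sum_congr rfl hterm, ← Finset.sum_filter, Finset.sum_const, nsmul_eq_mul, mul_comm]

end Maynard2016

end Literature.NumberTheory.Sieve

namespace Literature.NumberTheory.Sieve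

namespace Maynard2016

/-! ### (6.3)–(6.7): the count attached to one quadruple -/

/-- In the box `[1, X]^k` every coordinate is `≥ 1`. [folklore] -/
private theorem one_le_of_mem_box {k X : ℕ} {d : Fin k → ℕ} (hd : d ∈ box k X) (i : Fin k) :
    1 ≤ d i := by
  simp only [box, Fintype.mem_piFinset, Finset.mem_Icc] at hd
  exact (hd i).1

/-- `[a, b] ≤ ab`. [folklore] -/
private theorem lcm_le_mul {a b : ℕ} (ha : 0 < a) (hb : 0 < b) : Nat.lcm a b ≤ a * b :=
  Nat.le_of_dvd (Nat.mul_pos ha hb) (Nat.lcm_dvd_mul a b)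

/-- The real-number bookkeeping of (6.4)–(6.6): from `|cnt − N Φ/(P L)| ≤ Φ`, `Φ ≤ P`, `L ≥ 1` and
`|N − u| ≤ 1` we get `|λ cnt − u (Φ/P) (λ/L)| ≤ |λ| (P + 1)`. [folklore] -/
private theorem abs_mul_cnt_sub_le {l cnt N u Φ P L : ℝ} (hkey : |cnt - N * Φ / (P * L)| ≤ Φ)
    (hΦP : Φ ≤ P) (hΦ0 : 0 ≤ Φ) (hP : 0 < P) (hL : 1 ≤ L) (hNu : |N - u| ≤ 1) :
    |l * cnt - u * (Φ / P) * (l / L)| ≤ |l| * (P + 1) := by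
  have hL0 : 0 < L := by linarith
  have hPL : 0 < P * L := mul_pos hP hL0
  have h1 : l * cnt - u * (Φ / P) * (l / L) = l * (cnt - u * Φ / (P * L)) := by
    field_simp
  rw [h1, abs_mul]
  refine mul_le_mul_of_nonneg_left ?_ (abs_nonneg _)
  have h2 : |cnt - u * Φ / (P * L)| ≤
      |cnt - N * Φ / (P * L)| + |N * Φ / (P * L) - u * Φ / (P * L)| := abs_sub_le _ _ _
  have h3 : |N * Φ / (P * L) - u * Φ / (P * L)| ≤ 1 := by
    rw [← sub_div, ← sub_mul, abs_div, abs_mul, abs_of_pos hPL, abs_of_nonneg hΦ0, div_le_one hPL]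
    calc |N - u| * Φ ≤ 1 * P := mul_le_mul hNu hΦP hΦ0 (by norm_num)
      _ ≤ P * L := by rw [one_mul]; exact le_mul_of_one_le_right hP.le hL
  linarith [hΦP]

open scoped Classical in
/-- **The contribution of one quadruple `(d, d', e, e')`, (6.3)–(6.7).** For `x` large (`x^{1/5} < x/2`,
`y² < x/2`, the differences `h_j − h_i` having all prime factors `> x/2` in `P_w`), `q ≥ x/2` prime and
`d, d', e, e' ∈ [1,x]^k`:
`|λ_{d,e}λ_{d',e'} #{n : joint system} − (U/m)(φ_ω(P_w)/P_w) [Adm] λλ'/[d,d',e,e']| ≤ |λ_{d,e}| |λ_{d',e'}| (P_w + 1)`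
— if `λλ' ≠ 0` the moduli `[d_j,d'_j] ≤ x^{1/5}`, `[e_j,e'_j] ≤ y²` are `< q`, so either the system is
insoluble (no contribution, and `Adm` fails) or `Adm` holds and the count is `⌊U/m⌋ φ_ω(P_w)/(P_w [d,d',e,e'])
+ O(φ_ω(P_w))` by the Chinese remainder theorem. [cite: Maynard2016LargeGaps, §6 displays (6.3)–(6.7)] -/
theorem abs_quadTerm_sub_le {k J : ℕ} {c : Fin J → ℝ} {Fd : Fin k → Fin J → ℝ → ℝ} {G : ℝ → ℝ}
    (hD : IsSieveData k J c Fd G) {C_U ε : ℝ} {x : ℕ} (hx0 : (0 : ℝ) < x) (hlogx : 0 < Real.log x)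
    (hlogy : 0 < Real.log (y ε x))
    (hcop : ∀ i j : Fin k, i ≠ j → ∀ t : ℕ, Nat.Coprime t (Pw x) →
      Nat.Coprime t ((hTuple k x j : ℤ) - hTuple k x i).natAbs)
    (hX5 : (x : ℝ) ^ (1 / 5 : ℝ) < x / 2) (hy2 : (y ε x) ^ 2 < x / 2)
    {m q : ℕ} (hm : 1 ≤ m) (hU : 0 ≤ U C_U ε x / m) (hq : q.Prime) (hxq : (x : ℝ) / 2 ≤ q)
    {d d' e e' : Fin k → ℕ} (hd : d ∈ box k x) (hd' : d' ∈ box k x) (he : e ∈ box k x)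
    (he' : e' ∈ box k x) :
    |lam c Fd G ε x d e * lam c Fd G ε x d' e' *
          ((((baseSet C_U ε x m).filter (fun n => ∀ j ∈ (Finset.univ : Finset (Fin k)),
              Nat.lcm (d j) (d' j) ∣ n + hTuple k x j * q ∧
                Nat.lcm (e j) (e' j) ∣ m * (n + hTuple k x j * q) - 1)).card : ℕ) : ℝ) -
        U C_U ε x / m * (classCount x m / Pw x) *
          (if Adm k x m q d d' e e' then
            lam c Fd G ε x d e * lam c Fd G ε x d' e' /
              (Nat.lcm (∏ i, Nat.lcm (d i) (d' i)) (∏ i, Nat.lcm (e i) (e' i)) : ℝ)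
          else 0)| ≤
      |lam c Fd G ε x d e| * |lam c Fd G ε x d' e'| * ((Pw x : ℝ) + 1) := by
  by_cases hlam : lam c Fd G ε x d e = 0
  · simp [hlam]
  by_cases hlam' : lam c Fd G ε x d' e' = 0
  · simp [hlam']
  have hd1 := one_le_of_mem_box hd
  have hd'1 := one_le_of_mem_box hd'
  have he1 := one_le_of_mem_box he
  have he'1 := one_le_of_mem_box he'
  have hsq := squarefree_of_lam_ne_zero hlam
  have hsq' := squarefree_of_lam_ne_zero hlam'
  have hDsq : ∀ j, Squarefree (Nat.lcm (d j) (d' j)) := fun j =>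
    squarefree_lcm_of_squarefree (hsq j).1 (hsq' j).1
  have hEsq : ∀ j, Squarefree (Nat.lcm (e j) (e' j)) := fun j =>
    squarefree_lcm_of_squarefree (hsq j).2 (hsq' j).2
  have hD0 : ∀ j, 0 < Nat.lcm (d j) (d' j) := fun j => Nat.lcm_pos (hd1 j) (hd'1 j)
  have hE0 : ∀ j, 0 < Nat.lcm (e j) (e' j) := fun j => Nat.lcm_pos (he1 j) (he'1 j)
  have hy0 : 0 < y ε x := Real.exp_pos _
  -- the moduli are `< q`
  have hprod := prod_le_rpow_tenth_of_lam_ne_zero hD hlogx hd1 hlam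
  have hprod' := prod_le_rpow_tenth_of_lam_ne_zero hD hlogx hd'1 hlam'
  have hDq : ∀ j, Nat.lcm (d j) (d' j) < q := by
    intro j
    have h1 : (Nat.lcm (d j) (d' j) : ℝ) ≤ (d j : ℝ) * d' j := by
      exact_mod_cast lcm_le_mul (hd1 j) (hd'1 j)
    have h2 : (d j : ℝ) ≤ ∏ i, (d i : ℝ) := by
      have := Finset.single_le_prod' (f := fun i => d i) (fun i _ => hd1 i) (Finset.mem_univ j)
      exact_mod_cast this
    have h2' : (d' j : ℝ) ≤ ∏ i, (d' i : ℝ) := by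
      have := Finset.single_le_prod' (f := fun i => d' i) (fun i _ => hd'1 i) (Finset.mem_univ j)
      exact_mod_cast this
    have h3 : (d j : ℝ) * d' j ≤ (x : ℝ) ^ (1 / 10 : ℝ) * (x : ℝ) ^ (1 / 10 : ℝ) :=
      mul_le_mul (h2.trans hprod) (h2'.trans hprod') (by positivity) (by positivity)
    have h4 : (x : ℝ) ^ (1 / 10 : ℝ) * (x : ℝ) ^ (1 / 10 : ℝ) = (x : ℝ) ^ (1 / 5 : ℝ) := by
      rw [← Real.rpow_add hx0]; norm_num
    have h5 : (Nat.lcm (d j) (d' j) : ℝ) < q := by linarith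
    exact_mod_cast h5
  have hEq : ∀ j, Nat.lcm (e j) (e' j) < q := by
    intro j
    have h1 : (Nat.lcm (e j) (e' j) : ℝ) ≤ (e j : ℝ) * e' j := by
      exact_mod_cast lcm_le_mul (he1 j) (he'1 j)
    have h2 := le_y_of_lam_ne_zero hD hlogy hlam j
    have h2' := le_y_of_lam_ne_zero hD hlogy hlam' j
    have h3 : (e j : ℝ) * e' j ≤ (y ε x) ^ 2 := by
      rw [sq]; exact mul_le_mul h2 h2' (by positivity) hy0.le
    have h5 : (Nat.lcm (e j) (e' j) : ℝ) < q := by linarith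
    exact_mod_cast h5
  by_cases hAdm : Adm k x m q d d' e e'
  · rw [if_pos hAdm]
    obtain ⟨hDD, hEE, hDP, hEP, hEm, hX⟩ := hAdm
    have key := abs_card_filter_jointSys_sub_le C_U ε hm hq.pos hDsq hEsq hDD hEE hDP hEP hEm hX
    have hΦ : (((Finset.range (Pw x)).filter
        (fun n => Nat.Coprime (n * (m * n - 1)) (Pw x))).card : ℝ) = classCount x m := by
      rw [card_filter_range_Pw_coprime hm x]; rfl
    rw [hΦ] at key
    have hP : (0 : ℝ) < Pw x := by
      have : 0 < Pw x := by unfold Pw; exact primorial_pos _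
      exact_mod_cast this
    have hΦP : classCount x m ≤ Pw x := by
      rw [← hΦ]; exact_mod_cast card_classes_le_Pw x m
    have hL : (1 : ℝ) ≤ (Nat.lcm (∏ i, Nat.lcm (d i) (d' i)) (∏ i, Nat.lcm (e i) (e' i)) : ℕ) := by
      have h : 0 < Nat.lcm (∏ i, Nat.lcm (d i) (d' i)) (∏ i, Nat.lcm (e i) (e' i)) :=
        Nat.lcm_pos (Finset.prod_pos fun i _ => hD0 i) (Finset.prod_pos fun i _ => hE0 i)
      exact_mod_cast h
    have hNu : |(⌊U C_U ε x / m⌋₊ : ℝ) - U C_U ε x / m| ≤ 1 := by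
      have h1 := Nat.floor_le hU
      have h2 := Nat.lt_floor_add_one (U C_U ε x / m)
      rw [abs_le]
      constructor <;> linarith
    rw [← abs_mul]
    exact abs_mul_cnt_sub_le key hΦP (classCount_nonneg x m) hP hL hNu
  · rw [if_neg hAdm, mul_zero, sub_zero]
    have hempty : (baseSet C_U ε x m).filter (fun n => ∀ j ∈ (Finset.univ : Finset (Fin k)),
        Nat.lcm (d j) (d' j) ∣ n + hTuple k x j * q ∧
          Nat.lcm (e j) (e' j) ∣ m * (n + hTuple k x j * q) - 1) = ∅ := by
      refine Finset.filter_eq_empty_iff.2 fun n hn hsys => hAdm ?_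
      exact admDE_of_jointSys hq hm hcop hD0 hE0 hDq hEq hn hsys
    rw [hempty, Finset.card_empty, Nat.cast_zero, mul_zero, abs_zero]
    positivity

/-! ### (6.7): the total size of the weights -/

/-- **`Σ_{d,e ∈ [1,x]^k} |λ_{d,e}| ≤ Λ x^{1/10} (1 + log x)^k y^k`** (`|λ| ≤ Λ`, `∏ d_i ≤ x^{1/10}`,
`e_i ≤ y` on the support; `#{d : ∏ d_i ≤ X} ≤ X Σ_{d ∈ [1,x]^k} 1/∏ d_i = X (Σ_{t ≤ x} 1/t)^k`).
[cite: Maynard2016LargeGaps, §6 display (6.7)] -/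
theorem sum_abs_lam_le {k J : ℕ} {c : Fin J → ℝ} {Fd : Fin k → Fin J → ℝ → ℝ} {G : ℝ → ℝ}
    (hD : IsSieveData k J c Fd G) {ε : ℝ} {x : ℕ} (hx0 : (0 : ℝ) < x) (hlogx : 0 < Real.log x)
    (hlogy : 0 < Real.log (y ε x)) {Λ : ℝ} (hΛ0 : 0 ≤ Λ)
    (hΛ : ∀ d e : Fin k → ℕ, |lam c Fd G ε x d e| ≤ Λ) :
    ∑ d ∈ box k x, ∑ e ∈ box k x, |lam c Fd G ε x d e| ≤
      Λ * ((x : ℝ) ^ (1 / 10 : ℝ) * (1 + Real.log x) ^ k) * (y ε x) ^ k := by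
  classical
  have hy0 : 0 < y ε x := Real.exp_pos _
  set X : ℝ := (x : ℝ) ^ (1 / 10 : ℝ) with hX
  have hX0 : 0 < X := Real.rpow_pos_of_pos hx0 _
  -- a termwise majorant
  have hmaj : ∀ d ∈ box k x, ∀ e ∈ box k x, |lam c Fd G ε x d e| ≤
      Λ * (X * ∏ i, (1 / (d i : ℝ))) * (if ∀ i, (e i : ℝ) ≤ y ε x then (1 : ℝ) else 0) := by
    intro d hd e _
    have hd1 := one_le_of_mem_box hd
    have hprod0 : 0 < ∏ i, (d i : ℝ) := Finset.prod_pos fun i _ => by exact_mod_cast hd1 i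
    have hinv : X * ∏ i, (1 / (d i : ℝ)) = X / ∏ i, (d i : ℝ) := by
      simp only [one_div]
      rw [Finset.prod_inv_distrib, div_eq_mul_inv]
    have hnn : 0 ≤ Λ * (X * ∏ i, (1 / (d i : ℝ))) := by
      rw [hinv]; positivity
    by_cases hlam : lam c Fd G ε x d e = 0
    · rw [hlam, abs_zero]
      refine mul_nonneg hnn ?_
      split_ifs <;> norm_num
    · have h1 : 1 ≤ X * ∏ i, (1 / (d i : ℝ)) := by
        rw [hinv, one_le_div hprod0]
        exact prod_le_rpow_tenth_of_lam_ne_zero hD hlogx hd1 hlam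
      have h2 : (if ∀ i, (e i : ℝ) ≤ y ε x then (1 : ℝ) else 0) = 1 :=
        if_pos fun i => le_y_of_lam_ne_zero hD hlogy hlam i
      rw [h2, mul_one]
      calc |lam c Fd G ε x d e| ≤ Λ := hΛ d e
        _ = Λ * 1 := (mul_one _).symm
        _ ≤ Λ * (X * ∏ i, (1 / (d i : ℝ))) := mul_le_mul_of_nonneg_left h1 hΛ0
  -- summing the majorant
  have hsumd : ∑ d ∈ box k x, (X * ∏ i, (1 / (d i : ℝ))) ≤ X * (1 + Real.log x) ^ k := by
    rw [← Finset.mul_sum]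
    refine mul_le_mul_of_nonneg_left ?_ hX0.le
    have h : ∑ d ∈ box k x, ∏ i, (1 / (d i : ℝ)) =
        ∏ _i : Fin k, ∑ t ∈ Finset.Icc 1 x, (1 / (t : ℝ)) := by
      rw [box, Finset.prod_univ_sum]
    rw [h, Finset.prod_const, Finset.card_univ, Fintype.card_fin]
    exact pow_le_pow_left₀ (Finset.sum_nonneg fun t _ => by positivity) (sum_Icc_inv_le x) k
  have hsume : ∑ e ∈ box k x, (if ∀ i, (e i : ℝ) ≤ y ε x then (1 : ℝ) else 0) ≤ (y ε x) ^ k := by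
    rw [Finset.sum_boole]
    have hsub : (box k x).filter (fun e => ∀ i, (e i : ℝ) ≤ y ε x) ⊆
        Fintype.piFinset fun _ : Fin k => Finset.Icc 1 ⌊y ε x⌋₊ := by
      intro e he
      rw [Finset.mem_filter] at he
      rw [Fintype.mem_piFinset]
      intro i
      rw [Finset.mem_Icc]
      exact ⟨one_le_of_mem_box he.1 i, (Nat.le_floor_iff hy0.le).2 (he.2 i)⟩
    calc (((box k x).filter (fun e => ∀ i, (e i : ℝ) ≤ y ε x)).card : ℝ)
        ≤ (Fintype.piFinset fun _ : Fin k => Finset.Icc 1 ⌊y ε x⌋₊).card := by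
          exact_mod_cast Finset.card_le_card hsub
      _ = (⌊y ε x⌋₊ : ℝ) ^ k := by
          rw [Fintype.card_piFinset, Finset.prod_const, Finset.card_univ, Fintype.card_fin,
            Nat.card_Icc]
          push_cast
          simp
      _ ≤ (y ε x) ^ k := pow_le_pow_left₀ (Nat.cast_nonneg _) (Nat.floor_le hy0.le) k
  calc ∑ d ∈ box k x, ∑ e ∈ box k x, |lam c Fd G ε x d e|
      ≤ ∑ d ∈ box k x, ∑ e ∈ box k x,
          Λ * (X * ∏ i, (1 / (d i : ℝ))) * (if ∀ i, (e i : ℝ) ≤ y ε x then (1 : ℝ) else 0) :=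
        Finset.sum_le_sum fun d hd => Finset.sum_le_sum fun e he => hmaj d hd e he
    _ = Λ * ((∑ d ∈ box k x, (X * ∏ i, (1 / (d i : ℝ)))) *
          ∑ e ∈ box k x, (if ∀ i, (e i : ℝ) ≤ y ε x then (1 : ℝ) else 0)) := by
        rw [← Finset.sum_mul_sum, ← Finset.mul_sum, mul_assoc]
    _ ≤ Λ * ((X * (1 + Real.log x) ^ k) * (y ε x) ^ k) :=
        mul_le_mul_of_nonneg_left (mul_le_mul hsumd hsume
          (Finset.sum_nonneg fun e _ => by split_ifs <;> norm_num) (by positivity)) hΛ0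
    _ = Λ * ((x : ℝ) ^ (1 / 10 : ℝ) * (1 + Real.log x) ^ k) * (y ε x) ^ k := by rw [hX]; ring

/-! ### Sizes of the parameters -/

/-- `C log₃ x ≤ log₂ x` for all large `x`. [folklore] -/
private theorem eventually_mul_log₃_le_log₂ (C : ℝ) :
    ∀ᶠ x : ℕ in atTop, C * Real.log (Real.log (Real.log x)) ≤ Real.log (Real.log x) := by
  have hT₂ : Tendsto (fun x : ℕ => Real.log (Real.log x)) atTop atTop :=
    Real.tendsto_log_atTop.comp (Real.tendsto_log_atTop.comp tendsto_natCast_atTop_atTop)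
  have h : ∀ᶠ t : ℝ in atTop, C * Real.log t ≤ t := by
    by_cases hC : C ≤ 0
    · filter_upwards [eventually_ge_atTop (1 : ℝ)] with t ht
      have := Real.log_nonneg ht
      nlinarith
    · push Not at hC
      have hlo := Real.isLittleO_log_id_atTop.def (show 0 < 1 / C by positivity)
      filter_upwards [hlo, eventually_ge_atTop (1 : ℝ)] with t ht ht1
      rw [Real.norm_eq_abs, Real.norm_eq_abs, abs_of_nonneg (Real.log_nonneg ht1), id,
        abs_of_nonneg (by linarith : (0 : ℝ) ≤ t)] at ht
      calc C * Real.log t ≤ C * (1 / C * t) := mul_le_mul_of_nonneg_left ht hC.le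
        _ = t := by field_simp
  exact hT₂.eventually h

/-- The size facts used in (6.7), for `0 < ε ≤ 1/2`, `k ≥ 1` and all large `x`:
`y ≤ x`, `y^{2k} ≤ x^{1/4}`, `y² < x/2`, `x^{1/5} < x/2`, `P_w + 1 ≤ 2 (log x)³`. [cite: Maynard2016LargeGaps, §6 display (6.7)] -/
theorem eventually_sizes {ε : ℝ} (hε0 : 0 < ε) (hε : ε ≤ 1 / 2) {k : ℕ} (hk : 1 ≤ k) :
    ∀ᶠ x : ℕ in atTop, (1 : ℝ) ≤ x ∧ 1 ≤ Real.log x ∧ 0 < Real.log (Real.log x) ∧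
      0 < Real.log (y ε x) ∧ y ε x ≤ x ∧
      (y ε x) ^ (2 * k) ≤ (x : ℝ) ^ (1 / 4 : ℝ) ∧ (y ε x) ^ 2 < x / 2 ∧
      (x : ℝ) ^ (1 / 5 : ℝ) < x / 2 ∧ (Pw x : ℝ) + 1 ≤ 2 * (Real.log x) ^ 3 := by
  filter_upwards [eventually_iteratedLogs, eventually_wTrick hε,
    eventually_mul_log₃_le_log₂ (8 * (k : ℝ)), eventually_ge_atTop 1] with x hlogs hw h8k hx1
  obtain ⟨hL4, hL₂2, hL₃1, hL₃₂, hL₂L, -, -⟩ := hlogs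
  obtain ⟨-, hly, -, -, -, hPw⟩ := hw
  have hx1' : (1 : ℝ) ≤ x := by exact_mod_cast hx1
  have hx0 : (0 : ℝ) < x := by linarith
  have hL0 : 0 < Real.log x := by linarith
  have hL₂0 : 0 < Real.log (Real.log x) := by linarith
  have hL₃0 : 0 ≤ Real.log (Real.log (Real.log x)) := by linarith
  have hy0 : 0 < y ε x := Real.exp_pos _
  have hlyL : Real.log (y ε x) ≤ Real.log x :=
    log_y_le_log hε0.le (by linarith) hL0.le hL₂0 (by linarith)
  have hyx : y ε x ≤ x := (Real.log_le_log_iff hy0 hx0).1 hlyL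
  -- `y^{2k} ≤ x^{1/4}`
  have hy2k : (y ε x) ^ (2 * k) ≤ (x : ℝ) ^ (1 / 4 : ℝ) := by
    have hE : ((2 * k : ℕ) : ℝ) * ((1 - ε) * (Real.log x * Real.log (Real.log (Real.log x)) /
        Real.log (Real.log x))) ≤ Real.log x * (1 / 4) := by
      have h0 : 0 ≤ Real.log x * Real.log (Real.log (Real.log x)) / Real.log (Real.log x) := by
        positivity
      have h1 : (1 - ε) * (Real.log x * Real.log (Real.log (Real.log x)) /
          Real.log (Real.log x)) ≤
          Real.log x * Real.log (Real.log (Real.log x)) / Real.log (Real.log x) := by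
        nlinarith
      have h2 : ((2 * k : ℕ) : ℝ) * (Real.log x * Real.log (Real.log (Real.log x)) /
          Real.log (Real.log x)) ≤ Real.log x * (1 / 4) := by
        have h3 : ((2 * k : ℕ) : ℝ) * (Real.log x * Real.log (Real.log (Real.log x)) /
            Real.log (Real.log x)) =
            Real.log x * (2 * k * Real.log (Real.log (Real.log x)) / Real.log (Real.log x)) := by
          push_cast; ring
        rw [h3]
        refine mul_le_mul_of_nonneg_left ?_ hL0.le
        rw [div_le_iff₀ hL₂0]
        linarith
      calc ((2 * k : ℕ) : ℝ) * ((1 - ε) * (Real.log x * Real.log (Real.log (Real.log x)) /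
            Real.log (Real.log x)))
          ≤ ((2 * k : ℕ) : ℝ) * (Real.log x * Real.log (Real.log (Real.log x)) /
            Real.log (Real.log x)) := mul_le_mul_of_nonneg_left h1 (by positivity)
        _ ≤ Real.log x * (1 / 4) := h2
    unfold y
    rw [← Real.exp_nat_mul, Real.rpow_def_of_pos hx0, Real.exp_le_exp]
    exact hE
  -- `x^{1/4}, x^{1/5} < x/2`
  have hlog2 : Real.log 2 ≤ 1 := by
    have := Real.log_le_sub_one_of_pos (show (0 : ℝ) < 2 by norm_num)
    linarith
  have hhalf : (x : ℝ) / 2 = Real.exp (Real.log x - Real.log 2) := by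
    rw [Real.exp_sub, Real.exp_log hx0, Real.exp_log two_pos]
  have hx4 : (x : ℝ) ^ (1 / 4 : ℝ) < x / 2 := by
    rw [hhalf, Real.rpow_def_of_pos hx0, Real.exp_lt_exp]; linarith
  have hx5 : (x : ℝ) ^ (1 / 5 : ℝ) < x / 2 := by
    rw [hhalf, Real.rpow_def_of_pos hx0, Real.exp_lt_exp]; linarith
  -- `y² ≤ y^{2k}`
  have hy1 : 1 ≤ y ε x := by
    have := Real.add_one_le_exp (Real.log (y ε x))
    rw [Real.exp_log hy0] at this
    linarith
  have hy2 : (y ε x) ^ 2 < x / 2 :=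
    lt_of_le_of_lt ((pow_le_pow_right₀ hy1 (by omega)).trans hy2k) hx4
  -- `P_w + 1 ≤ 2 (log x)^3`
  have hP : (Pw x : ℝ) + 1 ≤ 2 * Real.log x ^ 3 := by
    have h1 : Real.log (Real.log (Real.log x)) ^ 3 ≤ Real.log x ^ 3 :=
      pow_le_pow_left₀ hL₃0 (by linarith) 3
    have h2 : (1 : ℝ) ≤ Real.log x ^ 3 := one_le_pow₀ (by linarith)
    linarith
  exact ⟨hx1', by linarith, hL₂0, hly, hyx, hy2k, hy2, hx5, hP⟩

/-! ### Proof of `Lemma6Counting` -/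

/-- `(0, 1/2] ∈ 𝓝[>] 0`. [folklore] -/
private theorem eventually_pos_le_half' : ∀ᶠ ε : ℝ in 𝓝[>] 0, 0 < ε ∧ ε ≤ 1 / 2 := by
  filter_upwards [Ioo_mem_nhdsGT (show (0 : ℝ) < 1 / 2 by norm_num)] with ε hε
  exact ⟨hε.1, hε.2.le⟩

open scoped Classical in
/-- **Maynard 2016, proof of Lemma 6, displays (6.1)–(6.7) — PROVED.** For `C_U > 0`, all small
`ε > 0`, `k ≥ 1` and smooth data: for all large `x`, every `m ≥ 1` and every prime `q ≥ x/2`,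
`|α_{m,q}⁻¹ − (U/m)(φ_ω(P_w)/P_w) Σ'_{d,d',e,e'} λλ'/[d,d',e,e']| ≤ x^{3/4}`.
[cite: Maynard2016LargeGaps, §6 displays (6.1)–(6.7)] -/
theorem lemma6Counting_holds : Lemma6Counting := by
  intro C_U hCU
  filter_upwards [eventually_pos_le_half'] with ε hε k hk J c Fd G hD
  obtain ⟨hε0, hε⟩ := hε
  obtain ⟨Λ, hΛ0, hΛ⟩ := exists_abs_lam_le hD
  -- the polylogarithmic factor: `(log x)^{2k+3} ≤ A x^{3/10}` eventually
  set A : ℝ := 1 / (2 ^ (2 * k + 1) * (Λ ^ 2 + 1)) with hA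
  have hApos : 0 < A := by positivity
  have hreal : ∀ᶠ X : ℝ in atTop, Real.log X ^ (2 * k + 3) ≤ A * X ^ (3 / 10 : ℝ) := by
    have hlo := (isLittleO_log_rpow_rpow_atTop ((2 * k + 3 : ℕ) : ℝ)
      (by norm_num : (0 : ℝ) < 3 / 10)).def hApos
    filter_upwards [hlo, eventually_ge_atTop (1 : ℝ)] with X hX hX1
    rw [Real.norm_eq_abs, Real.norm_eq_abs, Real.rpow_natCast,
      abs_of_nonneg (pow_nonneg (Real.log_nonneg hX1) _),
      abs_of_nonneg (Real.rpow_nonneg (by linarith) _)] at hX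
    exact hX
  filter_upwards [tendsto_natCast_atTop_atTop.eventually hreal, eventually_sizes hε0 hε hk,
    eventually_coprime_hTuple_sub k] with x hx hsz hcop m hm _hmev _hmU q hq hxq _hqx
  obtain ⟨hx1, hL1, hL₂0, hly, hyx, hy2k, hy2, hX5, hPw⟩ := hsz
  have hx0 : (0 : ℝ) < x := by linarith
  have hx1' : 1 ≤ x := by exact_mod_cast hx1
  have hL0 : 0 < Real.log x := by linarith
  have hm0 : (0 : ℝ) < m := by exact_mod_cast hm
  have hU : 0 ≤ U C_U ε x / m :=
    div_nonneg (U_pos hCU (by omega) hly hL₂0).le hm0.le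
  have hΛx : ∀ d e : Fin k → ℕ, |lam c Fd G ε x d e| ≤ Λ := fun d e => hΛ ε x d e hL0 hly
  -- Step 1: termwise, via `abs_quadTerm_sub_le`
  have hbound : |normInv c Fd G C_U ε x m q -
      U C_U ε x / m * (classCount x m / Pw x) * mainSum c Fd G ε x m q| ≤
      ∑ d ∈ box k x, ∑ d' ∈ box k x, ∑ e ∈ box k x, ∑ e' ∈ box k x,
        |lam c Fd G ε x d e| * |lam c Fd G ε x d' e'| * ((Pw x : ℝ) + 1) := by
    rw [normInv_eq_sum_box hD hx1' hL0 hly hyx hm hq.pos, mainSum, Finset.mul_sum,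
      ← Finset.sum_sub_distrib]
    refine (Finset.abs_sum_le_sum_abs _ _).trans (Finset.sum_le_sum fun d hd => ?_)
    rw [Finset.mul_sum, ← Finset.sum_sub_distrib]
    refine (Finset.abs_sum_le_sum_abs _ _).trans (Finset.sum_le_sum fun d' hd' => ?_)
    rw [Finset.mul_sum, ← Finset.sum_sub_distrib]
    refine (Finset.abs_sum_le_sum_abs _ _).trans (Finset.sum_le_sum fun e he => ?_)
    rw [Finset.mul_sum, ← Finset.sum_sub_distrib]
    refine (Finset.abs_sum_le_sum_abs _ _).trans (Finset.sum_le_sum fun e' he' => ?_)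
    exact abs_quadTerm_sub_le hD hx0 hL0 hly hcop hX5 hy2 hm hU hq hxq hd hd' he he'
  -- Step 2: the quadruple sum factors
  set S : ℝ := ∑ d ∈ box k x, ∑ e ∈ box k x, |lam c Fd G ε x d e| with hS
  have halg : ∑ d ∈ box k x, ∑ d' ∈ box k x, ∑ e ∈ box k x, ∑ e' ∈ box k x,
      |lam c Fd G ε x d e| * |lam c Fd G ε x d' e'| * ((Pw x : ℝ) + 1) =
      ((Pw x : ℝ) + 1) * (S * S) := by
    rw [hS, Finset.sum_mul_sum, Finset.mul_sum]
    refine Finset.sum_congr rfl fun d _ => ?_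
    rw [Finset.mul_sum]
    refine Finset.sum_congr rfl fun d' _ => ?_
    rw [Finset.sum_mul_sum, Finset.mul_sum]
    refine Finset.sum_congr rfl fun e _ => ?_
    rw [Finset.mul_sum]
    refine Finset.sum_congr rfl fun e' _ => ?_
    ring
  have hS0 : 0 ≤ S := Finset.sum_nonneg fun _ _ => Finset.sum_nonneg fun _ _ => abs_nonneg _
  have hSle : S ≤ Λ * ((x : ℝ) ^ (1 / 10 : ℝ) * (1 + Real.log x) ^ k) * (y ε x) ^ k :=
    sum_abs_lam_le hD hx0 hL0 hly hΛ0 hΛx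
  -- Step 3: the polylogarithmic factor is `≤ x^{3/10}`
  have hpoly : ((Pw x : ℝ) + 1) * Λ ^ 2 * (1 + Real.log x) ^ (2 * k) ≤ (x : ℝ) ^ (3 / 10 : ℝ) := by
    have h1 : (1 + Real.log x) ^ (2 * k) ≤ (2 * Real.log x) ^ (2 * k) :=
      pow_le_pow_left₀ (by positivity) (by linarith) _
    have h2 : 2 ^ (2 * k + 1) * Λ ^ 2 * A ≤ 1 := by
      rw [hA, mul_one_div, div_le_one (by positivity)]
      nlinarith [sq_nonneg Λ, pow_pos (show (0:ℝ) < 2 by norm_num) (2 * k + 1)]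
    calc ((Pw x : ℝ) + 1) * Λ ^ 2 * (1 + Real.log x) ^ (2 * k)
        ≤ (2 * Real.log x ^ 3) * Λ ^ 2 * (2 * Real.log x) ^ (2 * k) := by gcongr
      _ = 2 ^ (2 * k + 1) * Λ ^ 2 * Real.log x ^ (2 * k + 3) := by ring
      _ ≤ 2 ^ (2 * k + 1) * Λ ^ 2 * (A * (x : ℝ) ^ (3 / 10 : ℝ)) := by gcongr
      _ = (2 ^ (2 * k + 1) * Λ ^ 2 * A) * (x : ℝ) ^ (3 / 10 : ℝ) := by ring
      _ ≤ 1 * (x : ℝ) ^ (3 / 10 : ℝ) := by gcongr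
      _ = (x : ℝ) ^ (3 / 10 : ℝ) := one_mul _
  -- Step 4: assemble
  have hy0 : 0 < y ε x := Real.exp_pos _
  have hB0 : 0 ≤ Λ * ((x : ℝ) ^ (1 / 10 : ℝ) * (1 + Real.log x) ^ k) * (y ε x) ^ k := by
    positivity
  have hXX : (x : ℝ) ^ (1 / 10 : ℝ) * (x : ℝ) ^ (1 / 10 : ℝ) = (x : ℝ) ^ (1 / 5 : ℝ) := by
    rw [← Real.rpow_add hx0]; norm_num
  calc |normInv c Fd G C_U ε x m q - U C_U ε x / m * (classCount x m / Pw x) * mainSum c Fd G ε x m q|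
      ≤ ((Pw x : ℝ) + 1) * (S * S) := hbound.trans halg.le
    _ ≤ ((Pw x : ℝ) + 1) *
          ((Λ * ((x : ℝ) ^ (1 / 10 : ℝ) * (1 + Real.log x) ^ k) * (y ε x) ^ k) *
           (Λ * ((x : ℝ) ^ (1 / 10 : ℝ) * (1 + Real.log x) ^ k) * (y ε x) ^ k)) := by
        gcongr
    _ = (((Pw x : ℝ) + 1) * Λ ^ 2 * (1 + Real.log x) ^ (2 * k)) *
          ((x : ℝ) ^ (1 / 10 : ℝ) * (x : ℝ) ^ (1 / 10 : ℝ)) * (y ε x) ^ (2 * k) := by ring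
    _ ≤ (x : ℝ) ^ (3 / 10 : ℝ) * (x : ℝ) ^ (1 / 5 : ℝ) * (x : ℝ) ^ (1 / 4 : ℝ) := by
        rw [hXX]
        gcongr
    _ = (x : ℝ) ^ (3 / 4 : ℝ) := by
        rw [← Real.rpow_add hx0, ← Real.rpow_add hx0]; norm_num

/-- `Lemma6Counting` — `_holds` alias of `lemma6Counting_holds` above under the fact's exact name (appended
2026-08-28, D-0026 bookkeeping: the proof term is the existing theorem of this file; no statement,
definition or attribute is edited; no new named fact; the ledger's debt table listed the fact
unproved). [cite: Maynard2016LargeGaps, §6 displays (6.1)–(6.7)] -/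
theorem _root_.Literature.NumberTheory.Sieve.Maynard2016.Lemma6Counting_holds : Lemma6Counting :=
  _root_.Literature.NumberTheory.Sieve.Maynard2016.lemma6Counting_holds

end Maynard2016

end Literature.NumberTheory.Sieve
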